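import Summits.ResolutionOfSingularities.ResolutionOfSingularities.Theorems.FrobeniusLadderFInjectiveMacaulayficationPencilExitTagCode3
import Summits.ResolutionOfSingularities.ResolutionOfSingularities.Theorems.FrobeniusLadderFInjectiveMacaulayficationPencilExitTagCode1TwoUnit
import Mathlib.Algebra.Polynomial.Inductions
import HarnessLib

/-!
# TASK 4b SOUNDNESS, the TWO-UNIT TRANSVERSAL case of codes 1 and 3 of ✓p694236: `r|_Z = s|_Z = 0` and the point lies on the strict transform of the cusp, `χ(c) = c^r − c^s = 0`;
# the witness keeps ONE transversal letter `y_{i₁}` (`c_{i₁} ≠ 0`, `p ∤ r_{i₁} − s_{i₁}`) as a test variable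
# (crux `FInjectiveMacaulayfication` stmt-ResolutionOfSingularities-15315, chain w45a; RULING R23.8 (3), plan-1 ACK l.85626 «code 1 two-unit at χ(c) = 0 (transversal parameter
# y_{i₁} − c_{i₁}, p ≥ 5)»; consumer res-L1-w45a-stub-3 TASK 4c; seat res-L1-w45a-stub-1 g15)

[OURS · L1 W4.5a] Support file (`--supports stmt-ResolutionOfSingularities-15315 --as helper`); theorems only; unconditional; any field, every prime `p` (code 1) / odd `p` (code 3).
Nothing of the crux is proved; no census row is asserted. AI-written (AI review is weaker than expert review).

THE TRANSVERSAL SUBSTITUTION `Θ`: `W ↦ W + w₀`, `y_i ↦ y_i (i ∈ Z)`, `y_{i₁} ↦ y_{i₁} + c_{i₁}`, `y_i ↦ c_i` otherwise; test letters `T₀ = Z ∪ {i₁}`. Then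
`Θ(y^r − y^s) = ρ′(y_{i₁} + c i₁)^{r₁} − σ′(y_{i₁} + c i₁)^{s₁} =: P(y_{i₁})` with `P(0) = χ(c) = 0` and `P′(0)·c i₁ = (r₁ − s₁)·ρ′c i₁^{r₁} ≠ 0`, so `P = y_{i₁}·P₁`, `P₁(0) ≠ 0`
(`Polynomial.divX`), and `Θ(y^{M₂}χ) = y^{M₂|_Z}·y_{i₁}·u_B` with `u_B(0) ≠ 0`: the engine of ✓p699538 applies with the extra letter `i₁` in the target exponent
(code 1: `W⁰·y_{i₁}^{p−1}·y^{(p−1)M₂|_Z}`; code 3: `W^J·y_{i₁}^J·y^{J(M₁+M₂)|_Z}`; poles alike), every `w₀` by unitriangularity at a letter of `Z` with `M₁ ≥ 2` (else code 2).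
* §1 substitution lemmas (`constantCoeff_aeval_eq_eval`, `vT_shape`, `vT_monomial`, `constantCoeff_polynomial_aeval_X`, `natCast_ne_natCast_of_small`), ★ `transversal_decomposition`;
  §2 ★★ `fullCl_pencilChartW_code1_transversal`, ★★ `fullCl_pencilChartW_code1_twoUnit_all` (both two-unit sub-cases in one statement), ★★ `fullCl_pencilChartU_pole_code1_transversal`,
  `…U_pole_code1_twoUnit_all`; §3 ★★ `fullCl_pencilChartW_code3_transversal` / `…U_pole_code3_transversal` (`p` odd).
[cite: Fedder1983, Thm. 1.12]
-/

set_option linter.dupNamespace false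

noncomputable section

open AlgebraicGeometry IsLocalRing MvPolynomial
open scoped Pointwise

namespace Summit.ResolutionOfSingularities.ResolutionOfSingularities.Theorems.FInjectiveMacaulayfication.PencilExitTagTransversal

open Summit.ResolutionOfSingularities.ResolutionOfSingularities.Theorems.FInjectiveMacaulayfication
open SliceableCentre PencilExitTagW PencilExitWitness

variable (k : Type) [Field k] {n : ℕ}

/-! ## §1 The transversal substitution -/

/-- **Constant terms after a substitution whose letters have constant terms `c`** = evaluation at `c`. [plumbing] -/
theorem constantCoeff_aeval_eq_eval (v : Fin n → MvPolynomial (Fin n) k) (c : Fin n → k) (hv : ∀ i, constantCoeff (v i) = c i) (q : MvPolynomial (Fin n) k) :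
    constantCoeff (aeval v q) = eval c q := by
  induction q using MvPolynomial.induction_on with
  | C a => rw [aeval_C, algebraMap_eq, constantCoeff_C, eval_C]
  | add p q hp hq => rw [map_add, map_add, hp, hq, map_add]
  | mul_X p i hp => rw [map_mul, map_mul, hp, aeval_X, hv, map_mul, eval_X]

/-- The transversal substitution is of the shape the engine wants, test letters `Z ∪ {i₁}`. [plumbing] -/
theorem vT_shape [DecidableEq k] (c : Fin n → k) (i₁ : Fin n) (i : Fin n) :
    (fun i : Fin n => if i = i₁ then (X i₁ : MvPolynomial (Fin n) k) + C (c i₁) else if c i = 0 then X i else C (c i)) i = C (c i) ∨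
      (i ∈ ({i : Fin n | c i = 0} ∪ {i₁}) ∧
        (fun i : Fin n => if i = i₁ then (X i₁ : MvPolynomial (Fin n) k) + C (c i₁) else if c i = 0 then X i else C (c i)) i = X i + C (c i)) := by
  by_cases hi : i = i₁
  · right; subst hi; exact ⟨Set.mem_union_right _ rfl, by simp only [if_true]⟩
  · by_cases hci : c i = 0
    · right; refine ⟨Set.mem_union_left _ hci, ?_⟩; simp only [if_neg hi, if_pos hci]; rw [hci, C_0, add_zero]
    · left; simp only [if_neg hi, if_neg hci]

/-- The constant terms of the transversal substitution are the coordinates `c`. [plumbing] -/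
theorem constantCoeff_vT [DecidableEq k] (c : Fin n → k) (i₁ : Fin n) (i : Fin n) :
    constantCoeff ((fun i : Fin n => if i = i₁ then (X i₁ : MvPolynomial (Fin n) k) + C (c i₁) else if c i = 0 then X i else C (c i)) i) = c i := by
  dsimp only
  split_ifs with h1 h2
  · rw [map_add, constantCoeff_X, constantCoeff_C, zero_add, h1]
  · rw [constantCoeff_X, h2]
  · rw [constantCoeff_C]

/-- **The transversal substitution on a monomial**: `Θ(y^M) = (y_{i₁} + c i₁)^{M i₁} · γ · y^{M|_Z}`, `γ` = the value of `y^{M − M i₁·e_{i₁}}` off `Z` (`c_{i₁} ≠ 0`). [plumbing] -/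
theorem vT_monomial [DecidableEq k] (c : Fin n → k) (i₁ : Fin n) (hci₁ : c i₁ ≠ 0) (M : Fin n →₀ ℕ) :
    aeval (fun i : Fin n => if i = i₁ then (X i₁ : MvPolynomial (Fin n) k) + C (c i₁) else if c i = 0 then X i else C (c i)) (monomial M (1 : k)) =
      (X i₁ + C (c i₁)) ^ (M i₁) * (C (∏ i ∈ (M.erase i₁).support with c i ≠ 0, c i ^ (M.erase i₁) i) * monomial (M.filter fun i => c i = 0) 1) := by
  have hM : monomial M (1 : k) = X i₁ ^ (M i₁) * monomial (M.erase i₁) 1 := by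
    rw [X_pow_eq_monomial, monomial_mul, one_mul, Finsupp.single_add_erase]
  have hfilt : ((M.erase i₁).filter fun i => c i = 0) = M.filter fun i => c i = 0 := by
    ext i
    by_cases hi : i = i₁
    · subst hi; rw [Finsupp.filter_apply_neg (fun i => c i = 0) _ hci₁, Finsupp.filter_apply_neg (fun i => c i = 0) _ hci₁]
    · by_cases hci : c i = 0
      · rw [Finsupp.filter_apply_pos (fun i => c i = 0) _ hci, Finsupp.filter_apply_pos (fun i => c i = 0) _ hci, Finsupp.erase_ne hi]
      · rw [Finsupp.filter_apply_neg (fun i => c i = 0) _ hci, Finsupp.filter_apply_neg (fun i => c i = 0) _ hci]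
  have herase : aeval (fun i : Fin n => if i = i₁ then (X i₁ : MvPolynomial (Fin n) k) + C (c i₁) else if c i = 0 then X i else C (c i)) (monomial (M.erase i₁) (1 : k)) =
      aeval (fun i : Fin n => if c i = 0 then (X i : MvPolynomial (Fin n) k) else C (c i)) (monomial (M.erase i₁) (1 : k)) := by
    rw [aeval_monomial, aeval_monomial, Finsupp.prod, Finsupp.prod]
    congr 1
    refine Finset.prod_congr rfl fun i hi => ?_
    rw [Finsupp.support_erase, Finset.mem_erase] at hi
    simp only [if_neg hi.1]
  rw [hM, map_mul, map_pow, aeval_X]; simp only [if_true]; rw [herase, theta0_monomial, hfilt]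

/-- Constant term of a one-variable polynomial placed on the letter `y_i`. [plumbing] -/
theorem constantCoeff_polynomial_aeval_X (i : Fin n) (Q : Polynomial k) : constantCoeff (Polynomial.aeval (X i : MvPolynomial (Fin n) k) Q) = Q.coeff 0 := by
  induction Q using Polynomial.induction_on' with
  | add p q hp hq => rw [map_add, map_add, hp, hq, Polynomial.coeff_add]
  | monomial m a =>
    rw [Polynomial.aeval_monomial, map_mul, map_pow, constantCoeff_X, algebraMap_eq, constantCoeff_C, Polynomial.coeff_monomial]
    cases m with
    | zero => rw [pow_zero, mul_one, if_pos rfl]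
    | succ m => rw [zero_pow (Nat.succ_ne_zero m), mul_zero, if_neg (Nat.succ_ne_zero m)]

/-- `p ≥ 5` and `1 ≤ |r₁ − s₁| ≤ 4` (the `nonpdiv` clause of `exitOK`) ⇒ `r₁ ≠ s₁` in `k`. [plumbing] -/
theorem natCast_ne_natCast_of_small (p : ℕ) [Fact p.Prime] [CharP k p] (hp5 : 5 ≤ p) (r₁ s₁ : ℕ)
    (hd : 1 ≤ (r₁ - s₁) + (s₁ - r₁) ∧ (r₁ - s₁) + (s₁ - r₁) ≤ 4) : (r₁ : k) ≠ (s₁ : k) := by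
  intro h
  rw [CharP.natCast_eq_natCast k p] at h
  rcases le_total r₁ s₁ with hle | hle
  · have h1 := (Nat.modEq_iff_dvd' hle).1 h
    have h2 : s₁ - r₁ < p := by omega
    have h3 : 0 < s₁ - r₁ := by omega
    exact absurd (Nat.le_of_dvd h3 h1) (not_le.2 h2)
  · have h1 := (Nat.modEq_iff_dvd' hle).1 h.symm
    have h2 : r₁ - s₁ < p := by omega
    have h3 : 0 < r₁ - s₁ := by omega
    exact absurd (Nat.le_of_dvd h3 h1) (not_le.2 h2)

set_option maxHeartbeats 800000 in
-- polynomial bookkeeping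
/-- ★ **THE TRANSVERSAL DECOMPOSITION**: under `r|_Z = s|_Z = 0`, `χ(c) = 0`, `c_{i₁} ≠ 0`, `r_{i₁} ≠ s_{i₁}` in `k`:
`Θ(y^{M₁}) = y^{M₁|_Z}·u_A` and `Θ(y^{M₂}(y^r − y^s)) = y^{M₂|_Z + e_{i₁}}·u_B` with `u_A(0) ≠ 0 ≠ u_B(0)`. [OURS · TASK 4b soundness] -/
theorem transversal_decomposition [DecidableEq k] (M₁ M₂ r s : Fin n →₀ ℕ) (c : Fin n → k) (i₁ : Fin n) (hci₁ : c i₁ ≠ 0)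
    (hr0 : ∀ i, c i = 0 → r i = 0) (hs0 : ∀ i, c i = 0 → s i = 0) (hχ : eval c (monomial r (1 : k) - monomial s 1) = 0) (hne : (r i₁ : k) ≠ (s i₁ : k)) :
    ∃ uA uB : MvPolynomial (Fin n) k,
      aeval (fun i : Fin n => if i = i₁ then (X i₁ : MvPolynomial (Fin n) k) + C (c i₁) else if c i = 0 then X i else C (c i)) (monomial M₁ (1 : k)) =
          monomial (M₁.filter fun i => c i = 0) 1 * uA ∧
        aeval (fun i : Fin n => if i = i₁ then (X i₁ : MvPolynomial (Fin n) k) + C (c i₁) else if c i = 0 then X i else C (c i))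
            (monomial M₂ (1 : k) * (monomial r 1 - monomial s 1)) = monomial ((M₂.filter fun i => c i = 0) + Finsupp.single i₁ 1) 1 * uB ∧
        constantCoeff uA ≠ 0 ∧ constantCoeff uB ≠ 0 := by
  set vT : Fin n → MvPolynomial (Fin n) k := fun i => if i = i₁ then (X i₁ : MvPolynomial (Fin n) k) + C (c i₁) else if c i = 0 then X i else C (c i) with hvT
  set α' : k := ∏ i ∈ (M₁.erase i₁).support with c i ≠ 0, c i ^ (M₁.erase i₁) i with hα'
  set β' : k := ∏ i ∈ (M₂.erase i₁).support with c i ≠ 0, c i ^ (M₂.erase i₁) i with hβ'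
  set ρ' : k := ∏ i ∈ (r.erase i₁).support with c i ≠ 0, c i ^ (r.erase i₁) i with hρ'
  set σ' : k := ∏ i ∈ (s.erase i₁).support with c i ≠ 0, c i ^ (s.erase i₁) i with hσ'
  have hα'0 : α' ≠ 0 := theta0_scalar_ne_zero k c _
  have hβ'0 : β' ≠ 0 := theta0_scalar_ne_zero k c _
  have hρ'0 : ρ' ≠ 0 := theta0_scalar_ne_zero k c _
  -- the one-variable polynomial `P`
  set P : Polynomial k := Polynomial.C ρ' * (Polynomial.X + Polynomial.C (c i₁)) ^ (r i₁) - Polynomial.C σ' * (Polynomial.X + Polynomial.C (c i₁)) ^ (s i₁) with hP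
  have hr0' : (r.filter fun i => c i = 0) = 0 := (PencilExitTagCode3.filter_eq_zero_iff k c r).2 hr0
  have hs0' : (s.filter fun i => c i = 0) = 0 := (PencilExitTagCode3.filter_eq_zero_iff k c s).2 hs0
  have hχT : aeval vT (monomial r (1 : k) - monomial s 1) = Polynomial.aeval (X i₁ : MvPolynomial (Fin n) k) P := by
    rw [map_sub, hvT, vT_monomial k c i₁ hci₁, vT_monomial k c i₁ hci₁, hr0', hs0', ← C_apply, C_1, mul_one, mul_one, hP, map_sub, map_mul, map_mul, map_pow, map_pow,
      map_add, Polynomial.aeval_X, Polynomial.aeval_C, Polynomial.aeval_C, Polynomial.aeval_C, algebraMap_eq]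
    ring
  have hP0 : P.coeff 0 = 0 := by
    rw [← constantCoeff_polynomial_aeval_X k i₁ P, ← hχT, constantCoeff_aeval_eq_eval k vT c (constantCoeff_vT k c i₁), hχ]
  have hP0' : ρ' * c i₁ ^ (r i₁) = σ' * c i₁ ^ (s i₁) := by
    have h := hP0
    rw [hP, Polynomial.coeff_sub, Polynomial.coeff_C_mul, Polynomial.coeff_C_mul, Polynomial.coeff_X_add_C_pow, Polynomial.coeff_X_add_C_pow, Nat.sub_zero, Nat.sub_zero,
      Nat.choose_zero_right, Nat.choose_zero_right, Nat.cast_one, mul_one, mul_one, sub_eq_zero] at h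
    exact h
  have hpow : ∀ m : ℕ, c i₁ * (c i₁ ^ (m - 1) * (m : k)) = c i₁ ^ m * (m : k) := by
    intro m
    rcases Nat.eq_zero_or_pos m with rfl | hm
    · simp
    · rw [← mul_assoc, ← pow_succ', Nat.sub_add_cancel hm]
  have hP1 : P.coeff 1 ≠ 0 := by
    rw [hP, Polynomial.coeff_sub, Polynomial.coeff_C_mul, Polynomial.coeff_C_mul, Polynomial.coeff_X_add_C_pow, Polynomial.coeff_X_add_C_pow, Nat.choose_one_right,
      Nat.choose_one_right]
    intro h
    have h2 : c i₁ * (ρ' * (c i₁ ^ (r i₁ - 1) * (r i₁ : k)) - σ' * (c i₁ ^ (s i₁ - 1) * (s i₁ : k))) = ρ' * c i₁ ^ (r i₁) * ((r i₁ : k) - (s i₁ : k)) := by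
      linear_combination ρ' * hpow (r i₁) - σ' * hpow (s i₁) + (s i₁ : k) * hP0'
    rw [h, mul_zero] at h2
    exact mul_ne_zero (mul_ne_zero hρ'0 (pow_ne_zero _ hci₁)) (sub_ne_zero.2 hne) h2.symm
  -- `P = X · P₁`
  set P₁ := Polynomial.divX P with hP₁
  have hPX : P = Polynomial.X * P₁ := by
    have h := Polynomial.X_mul_divX_add P
    rw [hP0, map_zero, add_zero] at h
    exact h.symm
  have hP₁0 : P₁.coeff 0 ≠ 0 := by rw [hP₁, Polynomial.coeff_divX, zero_add]; exact hP1
  -- the decomposition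
  refine ⟨C α' * (X i₁ + C (c i₁)) ^ (M₁ i₁), C β' * (X i₁ + C (c i₁)) ^ (M₂ i₁) * Polynomial.aeval (X i₁ : MvPolynomial (Fin n) k) P₁, ?_, ?_, ?_, ?_⟩
  · rw [hvT, vT_monomial k c i₁ hci₁]; ring
  · rw [map_mul, hχT, hPX, map_mul, Polynomial.aeval_X, hvT, vT_monomial k c i₁ hci₁,
      show monomial ((M₂.filter fun i => c i = 0) + Finsupp.single i₁ 1) (1 : k) = monomial (M₂.filter fun i => c i = 0) 1 * X i₁ by
        rw [X, monomial_mul, mul_one]]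
    ring
  · rw [map_mul, map_pow, map_add, constantCoeff_C, constantCoeff_X, constantCoeff_C, zero_add]
    exact mul_ne_zero hα'0 (pow_ne_zero _ hci₁)
  · rw [map_mul, map_mul, map_pow, map_add, constantCoeff_C, constantCoeff_X, constantCoeff_C, zero_add, constantCoeff_polynomial_aeval_X]
    exact mul_ne_zero (mul_ne_zero hβ'0 (pow_ne_zero _ hci₁)) hP₁0

/-! ## §2 ★★ Code 1, transversal two-unit case -/

set_option maxHeartbeats 800000 in
-- polynomial bookkeeping
/-- ★★ **CODE 1, TWO-UNIT TRANSVERSAL CASE, `W`-chart**: `Φ_W = (y^{M₁})⁺·W − (y^{M₂}(y^r − y^s))⁺` is FULL at EVERY closed point `(w₀; c)` with `M₂ i ≤ 1` on `Z`, `r|_Z = s|_Z = 0`,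
`χ(c) = 0`, given a letter `i₁` with `c_{i₁} ≠ 0` and `r_{i₁} ≠ s_{i₁}` in `k` (`M₁ ⊥ M₂`; every prime). Witness `W⁰·y_{i₁}^{p−1}·y^{(p−1)M₂|_Z}`.
[OURS · TASK 4b soundness; cite: Fedder1983, Thm. 1.12] -/
theorem fullCl_pencilChartW_code1_transversal (p : ℕ) [Fact p.Prime] [CharP k p] (M₁ M₂ r s : Fin n →₀ ℕ) (hdisj : ∀ i, M₁ i = 0 ∨ M₂ i = 0)
    (Φ : MvPolynomial (Fin (n + 1)) k)
    (hΦ : Φ = rename Fin.succ (monomial M₁ (1 : k)) * X 0 - rename Fin.succ (monomial M₂ (1 : k) * (monomial r 1 - monomial s 1))) (hΦp : Prime Φ)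
    (c : Fin n → k) (w₀ : k) (y : Spec (.of (MvPolynomial (Fin (n + 1)) k ⧸ Ideal.span {Φ}))) (hy : y.asIdeal.IsMaximal)
    (ha : y.asIdeal.comap (Ideal.Quotient.mk (Ideal.span {Φ})) =
      Ideal.span (Set.range (Fin.cons ((X 0 : MvPolynomial (Fin (n + 1)) k) - C w₀) fun i : Fin n => X i.succ - C (c i))))
    (hM₂ : ∀ i, c i = 0 → M₂ i ≤ 1)
    (hr0 : ∀ i, c i = 0 → r i = 0) (hs0 : ∀ i, c i = 0 → s i = 0) (hχ : eval c (monomial r (1 : k) - monomial s 1) = 0)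
    (i₁ : Fin n) (hci₁ : c i₁ ≠ 0) (hne : (r i₁ : k) ≠ (s i₁ : k)) :
    FullCl p ((Spec (.of (MvPolynomial (Fin (n + 1)) k ⧸ Ideal.span {Φ}))).presheaf.stalk y) := by
  classical
  -- if `M₁|_Z ≤ 1` this is code 2
  by_cases hM₁ : ∀ i, c i = 0 → M₁ i ≤ 1
  · exact fullCl_pencilChartW_of_M₁_le_one k p M₁ _ Φ hΦ hΦp c w₀ y hy ha hM₁
  push Not at hM₁
  obtain ⟨i₀, hci₀, hM₁i₀⟩ := hM₁
  have hM₂i₀ : M₂ i₀ = 0 := (hdisj i₀).resolve_left (by omega)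
  have hi₀₁ : i₀ ≠ i₁ := by rintro rfl; exact hci₁ hci₀
  have hp1 : 1 ≤ p := (Fact.out : p.Prime).one_lt.le
  obtain ⟨uA, uB, hA, hB, huA, huB⟩ := transversal_decomposition k M₁ M₂ r s c i₁ hci₁ hr0 hs0 hχ hne
  set a := M₁.filter fun i => c i = 0 with ha'
  set b := (M₂.filter fun i => c i = 0) + Finsupp.single i₁ 1 with hb
  set N := p - 1 with hN
  set d₀ : Fin n →₀ ℕ := 0 • a + N • b with hd₀
  refine fullCl_linearChart_of_subst k p _ _ Φ hΦ hΦp c w₀ y hy ha _ ({i | c i = 0} ∪ {i₁}) (vT_shape k c i₁) 0 (Fact.out : p.Prime).pos d₀ (fun i hi => ?_) ?_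
  · rcases hi with hci | hi
    · rw [Set.mem_setOf_eq] at hci
      have hii : i ≠ i₁ := by rintro rfl; exact hci₁ hci
      rw [hd₀, zero_smul, zero_add, Finsupp.smul_apply, hb, Finsupp.add_apply, Finsupp.filter_apply_pos (fun i => c i = 0) M₂ hci, Finsupp.single_eq_of_ne hii,
        add_zero, smul_eq_mul]
      calc N * M₂ i ≤ N * 1 := Nat.mul_le_mul_left _ (hM₂ i hci)
        _ < p := by omega
    · rw [Set.mem_singleton_iff] at hi; subst hi
      rw [hd₀, zero_smul, zero_add, Finsupp.smul_apply, hb, Finsupp.add_apply, Finsupp.filter_apply_neg (fun i => c i = 0) M₂ hci₁, Finsupp.single_eq_same, zero_add,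
        smul_eq_mul, mul_one]
      omega
  · rw [hA, hB, Nat.sub_zero]
    rw [coeff_mul_pow_shift_eq k a uA (monomial b (1 : k) * uB) w₀ 0 N d₀
      ⟨i₀, by
        rw [hd₀, zero_smul, zero_add, Finsupp.smul_apply, hb, ha', Finsupp.add_apply, Finsupp.filter_apply_pos (fun i => c i = 0) M₂ hci₀,
          Finsupp.filter_apply_pos (fun i => c i = 0) M₁ hci₀, hM₂i₀, Finsupp.single_eq_of_ne hi₀₁, add_zero, smul_zero, zero_add, one_mul]
        omega⟩]
    rw [hd₀, coeff_pencil_target]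
    exact mul_ne_zero (mul_ne_zero (pow_ne_zero _ (neg_ne_zero.2 one_ne_zero)) (pow_ne_zero _ huA)) (pow_ne_zero _ huB)

/-- ★★ **CODE 1, THE WHOLE TWO-UNIT CASE IN ONE STATEMENT** (`r|_Z = s|_Z = 0` and a letter `i₁ ∉ Z` with `r_{i₁} ≠ s_{i₁}` in `k`): FULL at every `(w₀; c)` — by ✓p697883 when
`χ(c) ≠ 0`, by the transversal witness when `χ(c) = 0`. [OURS · TASK 4b soundness; cite: Fedder1983, Thm. 1.12] -/
theorem fullCl_pencilChartW_code1_twoUnit_all (p : ℕ) [Fact p.Prime] [CharP k p] (M₁ M₂ r s : Fin n →₀ ℕ) (hdisj : ∀ i, M₁ i = 0 ∨ M₂ i = 0)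
    (Φ : MvPolynomial (Fin (n + 1)) k)
    (hΦ : Φ = rename Fin.succ (monomial M₁ (1 : k)) * X 0 - rename Fin.succ (monomial M₂ (1 : k) * (monomial r 1 - monomial s 1))) (hΦp : Prime Φ)
    (c : Fin n → k) (w₀ : k) (y : Spec (.of (MvPolynomial (Fin (n + 1)) k ⧸ Ideal.span {Φ}))) (hy : y.asIdeal.IsMaximal)
    (ha : y.asIdeal.comap (Ideal.Quotient.mk (Ideal.span {Φ})) =
      Ideal.span (Set.range (Fin.cons ((X 0 : MvPolynomial (Fin (n + 1)) k) - C w₀) fun i : Fin n => X i.succ - C (c i))))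
    (hM₂ : ∀ i, c i = 0 → M₂ i ≤ 1)
    (hr0 : ∀ i, c i = 0 → r i = 0) (hs0 : ∀ i, c i = 0 → s i = 0)
    (i₁ : Fin n) (hci₁ : c i₁ ≠ 0) (hne : (r i₁ : k) ≠ (s i₁ : k)) :
    FullCl p ((Spec (.of (MvPolynomial (Fin (n + 1)) k ⧸ Ideal.span {Φ}))).presheaf.stalk y) := by
  by_cases hχ : eval c (monomial r (1 : k) - monomial s 1) = 0
  · exact fullCl_pencilChartW_code1_transversal k p M₁ M₂ r s hdisj Φ hΦ hΦp c w₀ y hy ha hM₂ hr0 hs0 hχ i₁ hci₁ hne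
  · exact PencilExitTagCode1TwoUnit.fullCl_pencilChartW_code1_twoUnit k p M₁ M₂ r s hdisj Φ hΦ hΦp c w₀ y hy ha hM₂ hr0 hs0 hχ

set_option maxHeartbeats 800000 in
-- polynomial bookkeeping
/-- ★★ **CODE 1, TWO-UNIT TRANSVERSAL CASE AT THE POLE**: `Φ_U = (y^{M₂}(y^r − y^s))⁺·U − (y^{M₁})⁺` is FULL at `(0; c)` with `M₂ i ≤ 1` on `Z`, `r|_Z = s|_Z = 0`, `χ(c) = 0`, given
`i₁` with `c_{i₁} ≠ 0`, `r_{i₁} ≠ s_{i₁}` in `k` (every prime; no condition on `M₁`). Witness `U^{p−1}·y_{i₁}^{p−1}·y^{(p−1)M₂|_Z}`. [OURS · TASK 4b soundness; cite: Fedder1983, Thm. 1.12] -/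
theorem fullCl_pencilChartU_pole_code1_transversal (p : ℕ) [Fact p.Prime] [CharP k p] (M₁ M₂ r s : Fin n →₀ ℕ)
    (Φ : MvPolynomial (Fin (n + 1)) k)
    (hΦ : Φ = rename Fin.succ (monomial M₂ (1 : k) * (monomial r 1 - monomial s 1)) * X 0 - rename Fin.succ (monomial M₁ (1 : k))) (hΦp : Prime Φ)
    (c : Fin n → k) (y : Spec (.of (MvPolynomial (Fin (n + 1)) k ⧸ Ideal.span {Φ}))) (hy : y.asIdeal.IsMaximal)
    (ha : y.asIdeal.comap (Ideal.Quotient.mk (Ideal.span {Φ})) =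
      Ideal.span (Set.range (Fin.cons (X 0 : MvPolynomial (Fin (n + 1)) k) fun i : Fin n => X i.succ - C (c i))))
    (hM₂ : ∀ i, c i = 0 → M₂ i ≤ 1)
    (hr0 : ∀ i, c i = 0 → r i = 0) (hs0 : ∀ i, c i = 0 → s i = 0) (hχ : eval c (monomial r (1 : k) - monomial s 1) = 0)
    (i₁ : Fin n) (hci₁ : c i₁ ≠ 0) (hne : (r i₁ : k) ≠ (s i₁ : k)) :
    FullCl p ((Spec (.of (MvPolynomial (Fin (n + 1)) k ⧸ Ideal.span {Φ}))).presheaf.stalk y) := by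
  classical
  have hp1 : 1 ≤ p := (Fact.out : p.Prime).one_lt.le
  obtain ⟨uA, uB, hA, hB, huA, huB⟩ := transversal_decomposition k M₁ M₂ r s c i₁ hci₁ hr0 hs0 hχ hne
  set a := M₁.filter fun i => c i = 0 with ha'
  set b := (M₂.filter fun i => c i = 0) + Finsupp.single i₁ 1 with hb
  set N := p - 1 with hN
  set d₀ : Fin n →₀ ℕ := N • b + 0 • a with hd₀
  refine fullCl_linearChart_pole_of_subst k p _ _ Φ hΦ hΦp c y hy ha _ ({i | c i = 0} ∪ {i₁}) (vT_shape k c i₁) N (by omega) d₀ (fun i hi => ?_) ?_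
  · rcases hi with hci | hi
    · rw [Set.mem_setOf_eq] at hci
      have hii : i ≠ i₁ := by rintro rfl; exact hci₁ hci
      rw [hd₀, zero_smul, add_zero, Finsupp.smul_apply, hb, Finsupp.add_apply, Finsupp.filter_apply_pos (fun i => c i = 0) M₂ hci, Finsupp.single_eq_of_ne hii,
        add_zero, smul_eq_mul]
      calc N * M₂ i ≤ N * 1 := Nat.mul_le_mul_left _ (hM₂ i hci)
        _ < p := by omega
    · rw [Set.mem_singleton_iff] at hi; subst hi
      rw [hd₀, zero_smul, add_zero, Finsupp.smul_apply, hb, Finsupp.add_apply, Finsupp.filter_apply_neg (fun i => c i = 0) M₂ hci₁, Finsupp.single_eq_same, zero_add,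
        smul_eq_mul, mul_one]
      omega
  · rw [hA, hB, show p - 1 - N = 0 by omega, hd₀, coeff_pencil_target]
    exact mul_ne_zero (mul_ne_zero (pow_ne_zero _ (neg_ne_zero.2 one_ne_zero)) (pow_ne_zero _ huB)) (pow_ne_zero _ huA)

/-- ★★ **CODE 1 AT THE POLE, THE WHOLE TWO-UNIT CASE.** [OURS · TASK 4b soundness; cite: Fedder1983, Thm. 1.12] -/
theorem fullCl_pencilChartU_pole_code1_twoUnit_all (p : ℕ) [Fact p.Prime] [CharP k p] (M₁ M₂ r s : Fin n →₀ ℕ) (hdisj : ∀ i, M₁ i = 0 ∨ M₂ i = 0)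
    (Φ : MvPolynomial (Fin (n + 1)) k)
    (hΦ : Φ = rename Fin.succ (monomial M₂ (1 : k) * (monomial r 1 - monomial s 1)) * X 0 - rename Fin.succ (monomial M₁ (1 : k))) (hΦp : Prime Φ)
    (c : Fin n → k) (y : Spec (.of (MvPolynomial (Fin (n + 1)) k ⧸ Ideal.span {Φ}))) (hy : y.asIdeal.IsMaximal)
    (ha : y.asIdeal.comap (Ideal.Quotient.mk (Ideal.span {Φ})) =
      Ideal.span (Set.range (Fin.cons (X 0 : MvPolynomial (Fin (n + 1)) k) fun i : Fin n => X i.succ - C (c i))))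
    (hM₂ : ∀ i, c i = 0 → M₂ i ≤ 1)
    (hr0 : ∀ i, c i = 0 → r i = 0) (hs0 : ∀ i, c i = 0 → s i = 0)
    (i₁ : Fin n) (hci₁ : c i₁ ≠ 0) (hne : (r i₁ : k) ≠ (s i₁ : k)) :
    FullCl p ((Spec (.of (MvPolynomial (Fin (n + 1)) k ⧸ Ideal.span {Φ}))).presheaf.stalk y) := by
  by_cases hχ : eval c (monomial r (1 : k) - monomial s 1) = 0
  · exact fullCl_pencilChartU_pole_code1_transversal k p M₁ M₂ r s Φ hΦ hΦp c y hy ha hM₂ hr0 hs0 hχ i₁ hci₁ hne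
  · exact PencilExitTagCode1TwoUnit.fullCl_pencilChartU_pole_code1_twoUnit k p M₁ M₂ r s hdisj Φ hΦ hΦp c y hy ha hM₂ hr0 hs0 hχ

/-! ## §3 ★★ Code 3, transversal two-unit case (`p` odd) -/

set_option maxHeartbeats 800000 in
-- polynomial bookkeeping
/-- ★★ **CODE 3, TWO-UNIT TRANSVERSAL CASE, `W`-chart**: `Φ_W` is FULL at EVERY `(w₀; c)` with `M₁ i + M₂ i ≤ 2` on `Z`, `r|_Z = s|_Z = 0`, `χ(c) = 0`, given `i₁` with `c_{i₁} ≠ 0`,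
`r_{i₁} ≠ s_{i₁}` in `k` (`p` odd; `M₁ ⊥ M₂`). Witness `W^J·y_{i₁}^J·y^{J(M₁+M₂)|_Z}`. [OURS · TASK 4b soundness; cite: Fedder1983, Thm. 1.12] -/
theorem fullCl_pencilChartW_code3_transversal (p : ℕ) [Fact p.Prime] [CharP k p] (hp2 : p ≠ 2) (M₁ M₂ r s : Fin n →₀ ℕ) (hdisj : ∀ i, M₁ i = 0 ∨ M₂ i = 0)
    (Φ : MvPolynomial (Fin (n + 1)) k)
    (hΦ : Φ = rename Fin.succ (monomial M₁ (1 : k)) * X 0 - rename Fin.succ (monomial M₂ (1 : k) * (monomial r 1 - monomial s 1))) (hΦp : Prime Φ)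
    (c : Fin n → k) (w₀ : k) (y : Spec (.of (MvPolynomial (Fin (n + 1)) k ⧸ Ideal.span {Φ}))) (hy : y.asIdeal.IsMaximal)
    (ha : y.asIdeal.comap (Ideal.Quotient.mk (Ideal.span {Φ})) =
      Ideal.span (Set.range (Fin.cons ((X 0 : MvPolynomial (Fin (n + 1)) k) - C w₀) fun i : Fin n => X i.succ - C (c i))))
    (htag : ∀ i, c i = 0 → M₁ i + M₂ i ≤ 2)
    (hr0 : ∀ i, c i = 0 → r i = 0) (hs0 : ∀ i, c i = 0 → s i = 0) (hχ : eval c (monomial r (1 : k) - monomial s 1) = 0)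
    (i₁ : Fin n) (hci₁ : c i₁ ≠ 0) (hne : (r i₁ : k) ≠ (s i₁ : k)) :
    FullCl p ((Spec (.of (MvPolynomial (Fin (n + 1)) k ⧸ Ideal.span {Φ}))).presheaf.stalk y) := by
  classical
  by_cases hM₁ : ∀ i, c i = 0 → M₁ i ≤ 1
  · exact fullCl_pencilChartW_of_M₁_le_one k p M₁ _ Φ hΦ hΦp c w₀ y hy ha hM₁
  push Not at hM₁
  obtain ⟨i₀, hci₀, hM₁i₀⟩ := hM₁
  have hM₂i₀ : M₂ i₀ = 0 := (hdisj i₀).resolve_left (by omega)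
  have hi₀₁ : i₀ ≠ i₁ := by rintro rfl; exact hci₁ hci₀
  have hp1 : 1 ≤ p := (Fact.out : p.Prime).one_lt.le
  have hJ := PencilExitTagCode3.two_mul_half p hp2
  set J := (p - 1) / 2 with hJdef
  obtain ⟨uA, uB, hA, hB, huA, huB⟩ := transversal_decomposition k M₁ M₂ r s c i₁ hci₁ hr0 hs0 hχ hne
  set a := M₁.filter fun i => c i = 0 with ha'
  set b := (M₂.filter fun i => c i = 0) + Finsupp.single i₁ 1 with hb
  set d₀ : Fin n →₀ ℕ := J • a + J • b with hd₀
  refine fullCl_linearChart_of_subst k p _ _ Φ hΦ hΦp c w₀ y hy ha _ ({i | c i = 0} ∪ {i₁}) (vT_shape k c i₁) J (by omega) d₀ (fun i hi => ?_) ?_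
  · rcases hi with hci | hi
    · rw [Set.mem_setOf_eq] at hci
      have hii : i ≠ i₁ := by rintro rfl; exact hci₁ hci
      rw [hd₀, Finsupp.add_apply, Finsupp.smul_apply, Finsupp.smul_apply, hb, ha', Finsupp.add_apply, Finsupp.filter_apply_pos (fun i => c i = 0) M₂ hci,
        Finsupp.filter_apply_pos (fun i => c i = 0) M₁ hci, Finsupp.single_eq_of_ne hii, add_zero, smul_eq_mul, smul_eq_mul, ← Nat.mul_add]
      calc J * (M₁ i + M₂ i) ≤ J * 2 := Nat.mul_le_mul_left _ (htag i hci)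
        _ < p := by omega
    · rw [Set.mem_singleton_iff] at hi; subst hi
      rw [hd₀, Finsupp.add_apply, Finsupp.smul_apply, Finsupp.smul_apply, hb, ha', Finsupp.add_apply, Finsupp.filter_apply_neg (fun i => c i = 0) M₂ hci₁,
        Finsupp.filter_apply_neg (fun i => c i = 0) M₁ hci₁, Finsupp.single_eq_same, zero_add, smul_zero, zero_add, smul_eq_mul, mul_one]
      omega
  · rw [hA, hB, show p - 1 - J = J by omega]
    rw [coeff_mul_pow_shift_eq k a uA (monomial b (1 : k) * uB) w₀ J J d₀
      ⟨i₀, by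
        rw [hd₀, Finsupp.add_apply, Finsupp.smul_apply, Finsupp.smul_apply, hb, ha', Finsupp.add_apply, Finsupp.filter_apply_pos (fun i => c i = 0) M₂ hci₀,
          Finsupp.filter_apply_pos (fun i => c i = 0) M₁ hci₀, hM₂i₀, Finsupp.single_eq_of_ne hi₀₁, add_zero, smul_zero, add_zero, smul_eq_mul, Nat.succ_mul]
        omega⟩]
    rw [hd₀, coeff_pencil_target]
    exact mul_ne_zero (mul_ne_zero (pow_ne_zero _ (neg_ne_zero.2 one_ne_zero)) (pow_ne_zero _ huA)) (pow_ne_zero _ huB)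

set_option maxHeartbeats 800000 in
-- polynomial bookkeeping
/-- ★★ **CODE 3, TWO-UNIT TRANSVERSAL CASE AT THE POLE**: `Φ_U` is FULL at `(0; c)` with `M₁ i + M₂ i ≤ 2` on `Z`, `r|_Z = s|_Z = 0`, `χ(c) = 0`, `i₁` as above (`p` odd; no
disjointness needed). Witness `U^J·y_{i₁}^J·y^{J(M₁+M₂)|_Z}`. [OURS · TASK 4b soundness; cite: Fedder1983, Thm. 1.12] -/
theorem fullCl_pencilChartU_pole_code3_transversal (p : ℕ) [Fact p.Prime] [CharP k p] (hp2 : p ≠ 2) (M₁ M₂ r s : Fin n →₀ ℕ)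
    (Φ : MvPolynomial (Fin (n + 1)) k)
    (hΦ : Φ = rename Fin.succ (monomial M₂ (1 : k) * (monomial r 1 - monomial s 1)) * X 0 - rename Fin.succ (monomial M₁ (1 : k))) (hΦp : Prime Φ)
    (c : Fin n → k) (y : Spec (.of (MvPolynomial (Fin (n + 1)) k ⧸ Ideal.span {Φ}))) (hy : y.asIdeal.IsMaximal)
    (ha : y.asIdeal.comap (Ideal.Quotient.mk (Ideal.span {Φ})) =
      Ideal.span (Set.range (Fin.cons (X 0 : MvPolynomial (Fin (n + 1)) k) fun i : Fin n => X i.succ - C (c i))))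
    (htag : ∀ i, c i = 0 → M₁ i + M₂ i ≤ 2)
    (hr0 : ∀ i, c i = 0 → r i = 0) (hs0 : ∀ i, c i = 0 → s i = 0) (hχ : eval c (monomial r (1 : k) - monomial s 1) = 0)
    (i₁ : Fin n) (hci₁ : c i₁ ≠ 0) (hne : (r i₁ : k) ≠ (s i₁ : k)) :
    FullCl p ((Spec (.of (MvPolynomial (Fin (n + 1)) k ⧸ Ideal.span {Φ}))).presheaf.stalk y) := by
  classical
  have hp1 : 1 ≤ p := (Fact.out : p.Prime).one_lt.le
  have hJ := PencilExitTagCode3.two_mul_half p hp2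
  set J := (p - 1) / 2 with hJdef
  obtain ⟨uA, uB, hA, hB, huA, huB⟩ := transversal_decomposition k M₁ M₂ r s c i₁ hci₁ hr0 hs0 hχ hne
  set a := M₁.filter fun i => c i = 0 with ha'
  set b := (M₂.filter fun i => c i = 0) + Finsupp.single i₁ 1 with hb
  set d₀ : Fin n →₀ ℕ := J • b + J • a with hd₀
  refine fullCl_linearChart_pole_of_subst k p _ _ Φ hΦ hΦp c y hy ha _ ({i | c i = 0} ∪ {i₁}) (vT_shape k c i₁) J (by omega) d₀ (fun i hi => ?_) ?_
  · rcases hi with hci | hi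
    · rw [Set.mem_setOf_eq] at hci
      have hii : i ≠ i₁ := by rintro rfl; exact hci₁ hci
      rw [hd₀, Finsupp.add_apply, Finsupp.smul_apply, Finsupp.smul_apply, hb, ha', Finsupp.add_apply, Finsupp.filter_apply_pos (fun i => c i = 0) M₂ hci,
        Finsupp.filter_apply_pos (fun i => c i = 0) M₁ hci, Finsupp.single_eq_of_ne hii, add_zero, smul_eq_mul, smul_eq_mul, ← Nat.mul_add, Nat.add_comm]
      calc J * (M₁ i + M₂ i) ≤ J * 2 := Nat.mul_le_mul_left _ (htag i hci)
        _ < p := by omega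
    · rw [Set.mem_singleton_iff] at hi; subst hi
      rw [hd₀, Finsupp.add_apply, Finsupp.smul_apply, Finsupp.smul_apply, hb, ha', Finsupp.add_apply, Finsupp.filter_apply_neg (fun i => c i = 0) M₂ hci₁,
        Finsupp.filter_apply_neg (fun i => c i = 0) M₁ hci₁, Finsupp.single_eq_same, zero_add, smul_zero, add_zero, smul_eq_mul, mul_one]
      omega
  · rw [hA, hB, show p - 1 - J = J by omega, hd₀, coeff_pencil_target]
    exact mul_ne_zero (mul_ne_zero (pow_ne_zero _ (neg_ne_zero.2 one_ne_zero)) (pow_ne_zero _ huB)) (pow_ne_zero _ huA)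

end Summit.ResolutionOfSingularities.ResolutionOfSingularities.Theorems.FInjectiveMacaulayfication.PencilExitTagTransversal

end
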